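import Mathlib.Analysis.SpecialFunctions.Pow.Real
import Mathlib.Data.Matrix.Mul
import Mathlib.LinearAlgebra.Matrix.Notation
import Mathlib.Tactic.FinCases

/-!
# Dimer-orbital projection: the "geometrical formulas" of the dimer model

In the dimerised organic charge-transfer salts (κ- and β-(BEDT-TTF)₂X) the four-band / two-band
molecular tight-binding model is reduced to a ONE-band "dimer model" by keeping, on each dimer,
one combination of the two molecular HOMOs.  The inter-dimer hopping of the dimer model is then
read off with the "geometrical formulas" `t = (t₂ + t₄)/2`, `t′ = t₃/2` (κ phase,
[KandpalEtAl2009, p. 3, following Komatsu et al. 1996]) or `t_x = −t_q2/2 + t_c`,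
`t_xy = −t_q1/2`, `t_y = −t_p2/2` (β phase, [SuzukiEtAl2011, §2]): every inter-dimer hopping of
the dimer model is HALF THE (signed) SUM of the molecular hoppings connecting the two dimers.

This file proves that bookkeeping as exact linear algebra on a two-dimer, four-site one-body
Hamiltonian `twoDimerHam` (sites `0, 1` = dimer A with intra-dimer hopping `t_A`, sites
`2, 3` = dimer B with `t_B`, the four inter-dimer hoppings `t₀₂, t₀₃, t₁₂, t₁₃`, on-site
energies `ε₀ … ε₃`):
* with the (unnormalised) symmetric / antisymmetric dimer orbitals `s_A = (1,1,0,0)`,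
  `a_A = (1,−1,0,0)`, `s_B = (0,0,1,1)`, `a_B = (0,0,1,−1)` (each of squared norm 2):
  `⟨s_A, H s_B⟩ = t₀₂ + t₀₃ + t₁₂ + t₁₃`, `⟨a_A, H a_B⟩ = t₀₂ − t₀₃ − t₁₂ + t₁₃`,
  `⟨s_A, H a_B⟩ = t₀₂ − t₀₃ + t₁₂ − t₁₃`, `⟨a_A, H s_B⟩ = t₀₂ + t₀₃ − t₁₂ − t₁₃`
  (`twoDimer_sym_sym` …) — hence the NORMALISED inter-dimer matrix elements are the half-sums
  (`dimerHop_sym_eq`, `dimerHop_anti_eq`, dividing by `√2 · √2 = 2`);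
* intra-dimer: `⟨s_A, H s_A⟩ = ε₀ + ε₁ + 2t_A`, `⟨a_A, H a_A⟩ = ε₀ + ε₁ − 2t_A`,
  `⟨s_A, H a_A⟩ = ε₀ − ε₁` (the symmetric/antisymmetric orbitals decouple iff the two molecules
  are equivalent; their splitting is `2t_A`) (`twoDimer_sym_sym_intra` …);
* the printed formulas as instances of the half-sum: κ phase `t = (t₂ + t₄)/2` (one `p` and one
  `q` contact), `t′ = t₃/2` (a single `b2` contact) (`kandpal2009_geometrical`); β phase
  `t_x = −t_q2/2 + t_c` (two `c` contacts and one `q2` contact entering with the printed sign),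
  `t_xy = −t_q1/2`, `t_y = −t_p2/2` (`suzuki2011_dimerMap`).
The relative signs inside the sums are fixed by the HOMO phase conventions of the cited papers;
here they are parameters.  The intra-dimer `2 × 2` block is `ladderBloch ε t_A` of
`LadderBandIdentities` (eigenvectors `(1, ±1)`), not repeated.

Not here: which combination (bonding or antibonding) carries the hole, interactions
(`U_dimer ≈ 2t_A` is `ExtendedHubbardDimerEffectiveU`), anything approximate.

References: H. C. Kandpal, I. Opahle, Y.-Z. Zhang, H. O. Jeschke, R. Valentí, Phys. Rev. Lett.
103 (2009) 067004, arXiv:0904.0302, p. 3; T. Suzuki, S. Onari, H. Ito, Y. Tanaka, J. Phys. Soc.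
Jpn. 80 (2011) 094704, arXiv:1008.4647, §2.  AI-produced formalisation (H21, cell
hubbard-downfold, seat lit-2, 2026-08-27); no facts, no axioms beyond Mathlib's, no `sorry`.
-/

namespace Literature.MathematicalPhysics.QuantumLattice

open Real Matrix

/-- One-body Hamiltonian of two dimers: sites `0, 1` (dimer A, intra-dimer hopping `tA`), sites
`2, 3` (dimer B, `tB`), on-site energies `ε₀ … ε₃`, inter-dimer hoppings `t₀₂, t₀₃, t₁₂, t₁₃`
(real symmetric). [cite: KandpalEtAl2009, p. 3] -/
def twoDimerHam (ε₀ ε₁ ε₂ ε₃ tA tB t₀₂ t₀₃ t₁₂ t₁₃ : ℝ) : Matrix (Fin 4) (Fin 4) ℝ :=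
  !![ε₀, tA, t₀₂, t₀₃; tA, ε₁, t₁₂, t₁₃; t₀₂, t₁₂, ε₂, tB; t₀₃, t₁₃, tB, ε₃]

/-- Unnormalised symmetric orbital of dimer A, `(1, 1, 0, 0)`. [cite: KandpalEtAl2009, p. 3] -/
def dimerSymA : Fin 4 → ℝ := ![1, 1, 0, 0]

/-- Unnormalised antisymmetric orbital of dimer A, `(1, −1, 0, 0)`. [cite: KandpalEtAl2009, p. 3] -/
def dimerAntiA : Fin 4 → ℝ := ![1, -1, 0, 0]

/-- Unnormalised symmetric orbital of dimer B, `(0, 0, 1, 1)`. [cite: KandpalEtAl2009, p. 3] -/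
def dimerSymB : Fin 4 → ℝ := ![0, 0, 1, 1]

/-- Unnormalised antisymmetric orbital of dimer B, `(0, 0, 1, −1)`. [cite: KandpalEtAl2009, p. 3] -/
def dimerAntiB : Fin 4 → ℝ := ![0, 0, 1, -1]

/-- Squared norms: each dimer orbital above has `v ⬝ᵥ v = 2`. [cite: KandpalEtAl2009, p. 3] -/
theorem dimerOrbital_normSq :
    dimerSymA ⬝ᵥ dimerSymA = 2 ∧ dimerAntiA ⬝ᵥ dimerAntiA = 2 ∧
      dimerSymB ⬝ᵥ dimerSymB = 2 ∧ dimerAntiB ⬝ᵥ dimerAntiB = 2 := by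
  simp [dimerSymA, dimerAntiA, dimerSymB, dimerAntiB, dotProduct, Fin.sum_univ_four]
  norm_num

/-- The A and B orbitals are mutually orthogonal, and `s_A ⊥ a_A`. [cite: KandpalEtAl2009, p. 3] -/
theorem dimerOrbital_orthogonal :
    dimerSymA ⬝ᵥ dimerAntiA = 0 ∧ dimerSymA ⬝ᵥ dimerSymB = 0 ∧ dimerSymA ⬝ᵥ dimerAntiB = 0 ∧
      dimerAntiA ⬝ᵥ dimerSymB = 0 ∧ dimerAntiA ⬝ᵥ dimerAntiB = 0 ∧
      dimerSymB ⬝ᵥ dimerAntiB = 0 := by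
  simp [dimerSymA, dimerAntiA, dimerSymB, dimerAntiB, dotProduct, Fin.sum_univ_four]

section MatrixElements

variable (ε₀ ε₁ ε₂ ε₃ tA tB t₀₂ t₀₃ t₁₂ t₁₃ : ℝ)

/-- **Symmetric–symmetric inter-dimer element**: `⟨s_A, H s_B⟩ = t₀₂ + t₀₃ + t₁₂ + t₁₃` (the
sum of all four molecular hoppings between the dimers). [cite: KandpalEtAl2009, p. 3] -/
theorem twoDimer_sym_sym :
    dimerSymA ⬝ᵥ (twoDimerHam ε₀ ε₁ ε₂ ε₃ tA tB t₀₂ t₀₃ t₁₂ t₁₃ *ᵥ dimerSymB)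
      = t₀₂ + t₀₃ + t₁₂ + t₁₃ := by
  simp [dimerSymA, dimerSymB, twoDimerHam, Matrix.mulVec, dotProduct, Fin.sum_univ_four]
  ring

/-- **Antisymmetric–antisymmetric inter-dimer element**:
`⟨a_A, H a_B⟩ = t₀₂ − t₀₃ − t₁₂ + t₁₃`. [cite: KandpalEtAl2009, p. 3] -/
theorem twoDimer_anti_anti :
    dimerAntiA ⬝ᵥ (twoDimerHam ε₀ ε₁ ε₂ ε₃ tA tB t₀₂ t₀₃ t₁₂ t₁₃ *ᵥ dimerAntiB)
      = t₀₂ - t₀₃ - t₁₂ + t₁₃ := by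
  simp [dimerAntiA, dimerAntiB, twoDimerHam, Matrix.mulVec, dotProduct, Fin.sum_univ_four]
  ring

/-- Mixed element `⟨s_A, H a_B⟩ = t₀₂ − t₀₃ + t₁₂ − t₁₃`. [cite: KandpalEtAl2009, p. 3] -/
theorem twoDimer_sym_anti :
    dimerSymA ⬝ᵥ (twoDimerHam ε₀ ε₁ ε₂ ε₃ tA tB t₀₂ t₀₃ t₁₂ t₁₃ *ᵥ dimerAntiB)
      = t₀₂ - t₀₃ + t₁₂ - t₁₃ := by
  simp [dimerSymA, dimerAntiB, twoDimerHam, Matrix.mulVec, dotProduct, Fin.sum_univ_four]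
  ring

/-- Mixed element `⟨a_A, H s_B⟩ = t₀₂ + t₀₃ − t₁₂ − t₁₃`. [cite: KandpalEtAl2009, p. 3] -/
theorem twoDimer_anti_sym :
    dimerAntiA ⬝ᵥ (twoDimerHam ε₀ ε₁ ε₂ ε₃ tA tB t₀₂ t₀₃ t₁₂ t₁₃ *ᵥ dimerSymB)
      = t₀₂ + t₀₃ - t₁₂ - t₁₃ := by
  simp [dimerAntiA, dimerSymB, twoDimerHam, Matrix.mulVec, dotProduct, Fin.sum_univ_four]
  ring

/-- Intra-dimer diagonal element of the symmetric orbital: `⟨s_A, H s_A⟩ = ε₀ + ε₁ + 2t_A`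
(normalised: `(ε₀ + ε₁)/2 + t_A`). [cite: SuzukiEtAl2011, §2] -/
theorem twoDimer_sym_sym_intra :
    dimerSymA ⬝ᵥ (twoDimerHam ε₀ ε₁ ε₂ ε₃ tA tB t₀₂ t₀₃ t₁₂ t₁₃ *ᵥ dimerSymA)
      = ε₀ + ε₁ + 2 * tA := by
  simp [dimerSymA, twoDimerHam, Matrix.mulVec, dotProduct, Fin.sum_univ_four]
  ring

/-- Intra-dimer diagonal element of the antisymmetric orbital: `⟨a_A, H a_A⟩ = ε₀ + ε₁ − 2t_A`
(normalised: `(ε₀ + ε₁)/2 − t_A`; splitting from the symmetric orbital `2t_A`).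
[cite: SuzukiEtAl2011, §2] -/
theorem twoDimer_anti_anti_intra :
    dimerAntiA ⬝ᵥ (twoDimerHam ε₀ ε₁ ε₂ ε₃ tA tB t₀₂ t₀₃ t₁₂ t₁₃ *ᵥ dimerAntiA)
      = ε₀ + ε₁ - 2 * tA := by
  simp [dimerAntiA, twoDimerHam, Matrix.mulVec, dotProduct, Fin.sum_univ_four]
  ring

/-- Intra-dimer mixing `⟨s_A, H a_A⟩ = ε₀ − ε₁`: the symmetric and antisymmetric dimer orbitals
decouple exactly iff the two molecules of the dimer are equivalent (`ε₀ = ε₁`).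
[cite: SuzukiEtAl2011, §2] -/
theorem twoDimer_sym_anti_intra :
    dimerSymA ⬝ᵥ (twoDimerHam ε₀ ε₁ ε₂ ε₃ tA tB t₀₂ t₀₃ t₁₂ t₁₃ *ᵥ dimerAntiA)
      = ε₀ - ε₁ := by
  simp [dimerSymA, dimerAntiA, twoDimerHam, Matrix.mulVec, dotProduct, Fin.sum_univ_four]
  ring

end MatrixElements

/-! ## The half-sum rule (normalised orbitals) and the printed geometrical formulas -/

/-- The dimer-model hopping between SYMMETRIC dimer orbitals as a function of the four
molecular contacts: the half-sum `(t₀₂ + t₀₃ + t₁₂ + t₁₃)/2`. [cite: KandpalEtAl2009, p. 3] -/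
noncomputable def dimerHopSym (t₀₂ t₀₃ t₁₂ t₁₃ : ℝ) : ℝ := (t₀₂ + t₀₃ + t₁₂ + t₁₃) / 2

/-- The dimer-model hopping between ANTISYMMETRIC dimer orbitals: the signed half-sum
`(t₀₂ − t₀₃ − t₁₂ + t₁₃)/2`. [cite: KandpalEtAl2009, p. 3] -/
noncomputable def dimerHopAnti (t₀₂ t₀₃ t₁₂ t₁₃ : ℝ) : ℝ := (t₀₂ - t₀₃ - t₁₂ + t₁₃) / 2

/-- Unfolding. [cite: KandpalEtAl2009, p. 3] -/
theorem dimerHopSym_def (t₀₂ t₀₃ t₁₂ t₁₃ : ℝ) :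
    dimerHopSym t₀₂ t₀₃ t₁₂ t₁₃ = (t₀₂ + t₀₃ + t₁₂ + t₁₃) / 2 := rfl

/-- Unfolding. [cite: KandpalEtAl2009, p. 3] -/
theorem dimerHopAnti_def (t₀₂ t₀₃ t₁₂ t₁₃ : ℝ) :
    dimerHopAnti t₀₂ t₀₃ t₁₂ t₁₃ = (t₀₂ - t₀₃ - t₁₂ + t₁₃) / 2 := rfl

/-- **Half-sum rule, symmetric orbitals**: the NORMALISED matrix element
`⟨s_A, H s_B⟩ / (‖s_A‖ ‖s_B‖)` with `‖s‖ = √2` equals `dimerHopSym`. [cite: KandpalEtAl2009, p. 3] -/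
theorem dimerHop_sym_eq (ε₀ ε₁ ε₂ ε₃ tA tB t₀₂ t₀₃ t₁₂ t₁₃ : ℝ) :
    dimerSymA ⬝ᵥ (twoDimerHam ε₀ ε₁ ε₂ ε₃ tA tB t₀₂ t₀₃ t₁₂ t₁₃ *ᵥ dimerSymB)
        / (Real.sqrt (dimerSymA ⬝ᵥ dimerSymA) * Real.sqrt (dimerSymB ⬝ᵥ dimerSymB))
      = dimerHopSym t₀₂ t₀₃ t₁₂ t₁₃ := by
  rw [twoDimer_sym_sym, dimerOrbital_normSq.1, dimerOrbital_normSq.2.2.1,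
    Real.mul_self_sqrt (by norm_num : (0:ℝ) ≤ 2), dimerHopSym]

/-- **Half-sum rule, antisymmetric orbitals**: the normalised `⟨a_A, H a_B⟩ / 2` equals
`dimerHopAnti`. [cite: KandpalEtAl2009, p. 3] -/
theorem dimerHop_anti_eq (ε₀ ε₁ ε₂ ε₃ tA tB t₀₂ t₀₃ t₁₂ t₁₃ : ℝ) :
    dimerAntiA ⬝ᵥ (twoDimerHam ε₀ ε₁ ε₂ ε₃ tA tB t₀₂ t₀₃ t₁₂ t₁₃ *ᵥ dimerAntiB)
        / (Real.sqrt (dimerAntiA ⬝ᵥ dimerAntiA) * Real.sqrt (dimerAntiB ⬝ᵥ dimerAntiB))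
      = dimerHopAnti t₀₂ t₀₃ t₁₂ t₁₃ := by
  rw [twoDimer_anti_anti, dimerOrbital_normSq.2.1, dimerOrbital_normSq.2.2.2,
    Real.mul_self_sqrt (by norm_num : (0:ℝ) ≤ 2), dimerHopAnti]

/-- The half-sum is linear and symmetric under relabelling the molecules of either dimer
(the symmetric-orbital hopping does not depend on which molecule carries which contact).
[cite: KandpalEtAl2009, p. 3] -/
theorem dimerHopSym_perm (t₀₂ t₀₃ t₁₂ t₁₃ : ℝ) :
    dimerHopSym t₀₂ t₀₃ t₁₂ t₁₃ = dimerHopSym t₁₂ t₁₃ t₀₂ t₀₃ ∧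
      dimerHopSym t₀₂ t₀₃ t₁₂ t₁₃ = dimerHopSym t₀₃ t₀₂ t₁₃ t₁₂ := by
  simp only [dimerHopSym]
  constructor <;> ring

/-- **κ phase geometrical formulas** [KandpalEtAl2009, p. 3, after Komatsu et al. 1996]: a
neighbouring dimer reached through ONE `p`-type contact `t₂` and ONE `q`-type contact `t₄`
gives `t = (t₂ + t₄)/2`; a dimer reached through a SINGLE `b2` contact `t₃` gives
`t′ = t₃/2`. [cite: KandpalEtAl2009, p. 3] -/
theorem kandpal2009_geometrical (t₂ t₃ t₄ : ℝ) :
    dimerHopSym t₂ 0 0 t₄ = (t₂ + t₄) / 2 ∧ dimerHopSym t₃ 0 0 0 = t₃ / 2 ∧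
      dimerHopSym 0 t₂ t₄ 0 = (t₂ + t₄) / 2 := by
  simp only [dimerHopSym]
  refine ⟨by ring, by ring, by ring⟩

/-- **β phase dimer map** [SuzukiEtAl2011, §2]: with the contacts entering the sums with the
printed signs — two `c` contacts and one `q2` contact (sign `−`) towards the `x` neighbour, one
`q1` contact (sign `−`) towards the `xy` neighbour, one `p2` contact (sign `−`) towards the `y`
neighbour — the half-sums are `t_x = −t_q2/2 + t_c`, `t_xy = −t_q1/2`, `t_y = −t_p2/2`; e.g.
β-(BEDT-TTF)₂I₃ (`t_c, t_p2, t_q1, t_q2 = −5.22, 8.23, 12.6, 6.91 × 10⁻² eV`) ⇒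
`t_x = −8.675`, `t_xy = −6.3`, `t_y = −4.115` (`× 10⁻² eV`). [cite: SuzukiEtAl2011, §2] -/
theorem suzuki2011_dimerMap (tc tp2 tq1 tq2 : ℝ) :
    dimerHopSym tc (-tq2) 0 tc = -tq2 / 2 + tc ∧ dimerHopSym (-tq1) 0 0 0 = -tq1 / 2 ∧
      dimerHopSym (-tp2) 0 0 0 = -tp2 / 2 ∧
      (dimerHopSym (-5.22) (-6.91) 0 (-5.22) = -8.675 ∧ dimerHopSym (-12.6) 0 0 0 = -6.3 ∧
        dimerHopSym (-8.23) 0 0 0 = -4.115) := by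
  simp only [dimerHopSym]
  refine ⟨by ring, by ring, by ring, by norm_num, by norm_num, by norm_num⟩

end Literature.MathematicalPhysics.QuantumLattice
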